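import Summits.Parity.GeneralizedHardyLittlewood.Theorems.PrimeLevelFamEdgeMomentsBeyondDiagonalDiagDecorShiftedBlockDecorTwoLog
import HarnessLib

/-!
# Route `PrimeLevelFamEdge`, crux K_A `MomentsBeyondDiagonal` (stmt-Parity-20007), line «petersson_layers» v4, stub `stub_diag`:
# **the TWO-SIDED decorated shifted block at the level of the Selberg form (part 2: expansion, block asymptotic, `P₂⊗P₂`):
# `Sel(τD₁(k₁)ℓ⁺(k₁)^{r₁}·τD₂(k₂)ℓ⁺(k₂)^{r₂}·B^p) = (π²/6)²(∫₀¹(λ−u)^pR^{(1)}_{r₁}R^{(2)}_{r₂})·log^{p+r₁+r₂}M·log M/log^{s₁+s₂}M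
# + O(log^{p+r₁+r₂}M/log^{s₁+s₂}M)`, and the instance `D₁ = D₂ = P₂` of order `(2,2)`**

Census R3(ii), ANALYTIC HALF; the two-sided twin of `…DiagDecorShiftedBlockDecor` / `…DiagDecorShiftedBlockDecorSel` (p825085,
p825169: ONE decorated coordinate), on top of the two-sided harmonic core `…DiagDecorShiftedBlockDecorTwo`. Needed from order
`(2,2)` on (`…DiagDecorOrderRungTwoHecke.heckeSum_orderTwoTwo_eq`: the two-sided decoration `τP₂(k₁)·τP₂(k₂)` in `3S₂² − 2S₄`),
and for every higher order (`…DiagDecorOrderHecke`: separable monomials `M_t(k₁)M_{t′}(k₂)L^m`). Same proofs as the one-sided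
files with the undecorated coordinate `𝒮^{[r₂]}` (master family `((X^rP)″, 2)`, crude size `abs_shiftedCoord_le`) replaced by a
second decorated coordinate with its own master family `(R^{(2)}_r, s₂)` (crude size from `abs_profileCoord_crude_le`):

* `abs_collapseShiftedDecorTwo_logPow_le` — the `(log g)^t` pieces (`t ≥ 1`) are `O(log^{t+q+r₁+r₂}M/log^{s₁+s₂}M)`;
* `selbergBlockDecorTwo_expand` — exact expansion along `−log g`;
* `abs_selbergBlockDecorTwo_sub_le` — **the two-sided block asymptotic displayed in the title**;
* `abs_selbergBlockPrimeSqTwo_sub_le` — **the instance `D₁ = D₂ = P₂`** (`R_r = −2X^rP`, `s = 0` twice):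
  `Sel(τP₂ℓ⁺^{r₁}·τP₂ℓ⁺^{r₂}·B^p) = (π²/6)²(∫₀¹(λ−u)^p(−2u^{r₁}P)(−2u^{r₂}P))·log^{p+r₁+r₂}M·log M + O(log^{p+r₁+r₂}M)` — with
  `…DiagDecorShiftedLpow` / `…DiagDecorShiftedP2Lpow` this evaluates every main-term monomial family of order `(2,2)` except the
  `M_4`-decorated ones, which carry no top-order main term.

Def-free; theorems only. Helper `--supports stmt-Parity-20007`; closes nothing; K_A, K_B and the Parity summit are NOT
proved; nothing about Landau–Siegel zeros.

## References
* E. Kowalski, P. Michel, J. VanderKam, J. reine angew. Math. 526 (2000), (23)–(28) pp. 13–15 and Prop. 5.1 p. 18.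
  [cite: KowalskiMichelVanderKam2000, (23)–(28) — derivation (diagonal main term in real Selberg coordinates)]
-/

noncomputable section

open scoped Real ArithmeticFunction.Moebius
open Finset ArithmeticFunction Polynomial MeasureTheory intervalIntegral

namespace Summit.Parity.GeneralizedHardyLittlewood.Theorems.MomentsBeyondDiagonal.DiagKernel

open Literature.NumberTheory.LFunctions Literature.NumberTheory.LFunctions.KMV2000
open MollifierMainTerm (W)
open SelbergCoord (kappa)
open Literature.NumberTheory.Sieve (one_le_log_of_three_le)
open Summit.Parity.GeneralizedHardyLittlewood.Theorems.BeyondDiagonalBeatsQuarter.KernelFormXSq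
  (mainConst divWeight divWeight_nonneg mainConst_nonneg abs_W_le sum_kappa_divWeight_sq_div_le)

variable (D₁ D₂ : ℕ → ℝ) (R₁ R₂ : ℕ → ℝ[X]) (s₁ s₂ : ℕ)

/-- Binomial bookkeeping: `μ(g)c·(a − log g)^p·(x(y₁y₂)) = Σ_t C(p,t)(−1)^t·(μ(g)c(log g)^t·(x(a^{p−t}y₁y₂)))`. [folklore] -/
private theorem moebius_mul_sub_log_pow_eq₂ (g : ℕ) (cc a x y₁ y₂ : ℝ) (p : ℕ) :
    (μ g : ℝ) * cc * ((a - Real.log g) ^ p * (x * (y₁ * y₂))) =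
      ∑ t ∈ Finset.range (p + 1), (p.choose t : ℝ) * (-1) ^ t *
        ((μ g : ℝ) * cc * Real.log g ^ t * (x * (a ^ (p - t) * y₁ * y₂))) := by
  rw [show a - Real.log g = -Real.log g + a by ring, add_pow, Finset.sum_mul, Finset.mul_sum]
  refine Finset.sum_congr rfl fun t _ ↦ ?_
  rw [neg_pow]
  ring

/-- Assembly bookkeeping: `|Σ_{t≤p}F(t) − main| ≤ (C₀ + Σ_{t<p}K(t+1))·X`. [folklore] -/
private theorem abs_sum_range_succ_sub_le₂ {p : ℕ} (F : ℕ → ℝ) (main X C₀ : ℝ) (K : ℕ → ℝ)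
    (h0 : |F 0 - main| ≤ C₀ * X) (hK : ∀ t ∈ Finset.range p, |F (t + 1)| ≤ K (t + 1) * X) :
    |∑ t ∈ Finset.range (p + 1), F t - main| ≤ (C₀ + ∑ t ∈ Finset.range p, K (t + 1)) * X := by
  rw [Finset.sum_range_succ', show ∑ t ∈ Finset.range p, F (t + 1) + F 0 - main =
    (F 0 - main) + ∑ t ∈ Finset.range p, F (t + 1) by ring]
  calc _ ≤ |F 0 - main| + |∑ t ∈ Finset.range p, F (t + 1)| := abs_add_le _ _
    _ ≤ C₀ * X + ∑ t ∈ Finset.range p, K (t + 1) * X :=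
        add_le_add h0 ((Finset.abs_sum_le_sum_abs _ _).trans (Finset.sum_le_sum hK))
    _ = (C₀ + ∑ t ∈ Finset.range p, K (t + 1)) * X := by rw [← Finset.sum_mul]; ring

/-! ### Exact expansion -/

/-- **Exact expansion of a two-sided decorated shifted block** along `B = (λlog M − log(M/(cg))) − log g`.
[cite: KowalskiMichelVanderKam2000, (23) — derivation] -/
theorem selbergBlockDecorTwo_expand (P : ℝ[X]) (M lam : ℝ) (p r₁ r₂ : ℕ) :
    ∑ c ∈ Icc 1 ⌊M⌋₊, ∑ g ∈ Icc 1 (⌊M⌋₊ / c), (μ g : ℝ) * c *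
        ∑ k₁ ∈ Icc 1 (⌊M⌋₊ / (c * g)), ∑ k₂ ∈ Icc 1 (⌊M⌋₊ / (c * g)),
          ((μ (c * g * k₁) : ℝ) * ((psi (c * g * k₁))⁻¹ *
              P.eval (Real.log (M / ((c * g * k₁ : ℕ) : ℝ)) / Real.log M))) / ((c * g * k₁ : ℕ) : ℝ) *
            (((μ (c * g * k₂) : ℝ) * ((psi (c * g * k₂))⁻¹ *
              P.eval (Real.log (M / ((c * g * k₂ : ℕ) : ℝ)) / Real.log M))) / ((c * g * k₂ : ℕ) : ℝ)) *
            (((k₁.divisors.card : ℝ) * D₁ k₁ * Real.log (M / ((c * g : ℕ) : ℝ) / k₁) ^ r₁) *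
              ((k₂.divisors.card : ℝ) * D₂ k₂ * Real.log (M / ((c * g : ℕ) : ℝ) / k₂) ^ r₂) *
              (lam * Real.log M - Real.log g - Real.log (M / ((c * g : ℕ) : ℝ))) ^ p) =
      ∑ t ∈ Finset.range (p + 1), (p.choose t : ℝ) * (-1) ^ t *
        ∑ c ∈ Icc 1 ⌊M⌋₊, ∑ g ∈ Icc 1 (⌊M⌋₊ / c), (μ g : ℝ) * c * Real.log g ^ t * (W (c * g) ^ 2 *
          ((lam * Real.log M - Real.log (M / ((c * g : ℕ) : ℝ))) ^ (p - t) *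
            (∑ c' ∈ Finset.range (P.natDegree + 1), P.coeff c' *
              ((∑ k ∈ Icc 1 ⌊M / ((c * g : ℕ) : ℝ)⌋₊, (if k.Coprime (c * g) then W k else 0) *
                ((k.divisors.card : ℝ) * D₁ k) * Real.log (M / ((c * g : ℕ) : ℝ) / k) ^ (c' + r₁)) / Real.log M ^ c')) *
            (∑ c' ∈ Finset.range (P.natDegree + 1), P.coeff c' *
              ((∑ k ∈ Icc 1 ⌊M / ((c * g : ℕ) : ℝ)⌋₊, (if k.Coprime (c * g) then W k else 0) * ((k.divisors.card : ℝ) * D₂ k) *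
                Real.log (M / ((c * g : ℕ) : ℝ) / k) ^ (c' + r₂)) / Real.log M ^ c')))) := by
  set S₁ : ℕ → ℝ := fun n ↦ ∑ c' ∈ Finset.range (P.natDegree + 1), P.coeff c' *
    ((∑ k ∈ Icc 1 ⌊M / n⌋₊, (if k.Coprime n then W k else 0) * ((k.divisors.card : ℝ) * D₁ k) *
      Real.log (M / n / k) ^ (c' + r₁)) / Real.log M ^ c') with hS₁
  set S₂ : ℕ → ℝ := fun n ↦ ∑ c' ∈ Finset.range (P.natDegree + 1), P.coeff c' *
    ((∑ k ∈ Icc 1 ⌊M / n⌋₊, (if k.Coprime n then W k else 0) * ((k.divisors.card : ℝ) * D₂ k) *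
      Real.log (M / n / k) ^ (c' + r₂)) / Real.log M ^ c') with hS₂
  have hinner : ∀ c ∈ Icc 1 ⌊M⌋₊, ∀ g ∈ Icc 1 (⌊M⌋₊ / c),
      ∑ k₁ ∈ Icc 1 (⌊M⌋₊ / (c * g)), ∑ k₂ ∈ Icc 1 (⌊M⌋₊ / (c * g)),
          ((μ (c * g * k₁) : ℝ) * ((psi (c * g * k₁))⁻¹ *
              P.eval (Real.log (M / ((c * g * k₁ : ℕ) : ℝ)) / Real.log M))) / ((c * g * k₁ : ℕ) : ℝ) *
            (((μ (c * g * k₂) : ℝ) * ((psi (c * g * k₂))⁻¹ *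
              P.eval (Real.log (M / ((c * g * k₂ : ℕ) : ℝ)) / Real.log M))) / ((c * g * k₂ : ℕ) : ℝ)) *
            (((k₁.divisors.card : ℝ) * D₁ k₁ * Real.log (M / ((c * g : ℕ) : ℝ) / k₁) ^ r₁) *
              ((k₂.divisors.card : ℝ) * D₂ k₂ * Real.log (M / ((c * g : ℕ) : ℝ) / k₂) ^ r₂) *
              (lam * Real.log M - Real.log g - Real.log (M / ((c * g : ℕ) : ℝ))) ^ p) =
        (lam * Real.log M - Real.log g - Real.log (M / ((c * g : ℕ) : ℝ))) ^ p *
          (W (c * g) ^ 2 * (S₁ (c * g) * S₂ (c * g))) := by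
    intro c hc g hg
    have hc0 : c ≠ 0 := by have := (Finset.mem_Icc.1 hc).1; omega
    have hg0 : g ≠ 0 := by have := (Finset.mem_Icc.1 hg).1; omega
    set Bp := (lam * Real.log M - Real.log g - Real.log (M / ((c * g : ℕ) : ℝ))) ^ p with hBp
    set t₁ : ℕ → ℝ := fun k ↦ (k.divisors.card : ℝ) * D₁ k * Real.log (M / ((c * g : ℕ) : ℝ) / k) ^ r₁ with ht₁
    set t₂ : ℕ → ℝ := fun k ↦ (k.divisors.card : ℝ) * D₂ k * Real.log (M / ((c * g : ℕ) : ℝ) / k) ^ r₂ * Bp with ht₂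
    have h := selbergInner_eq_W_sq_mul P M (mul_ne_zero hc0 hg0) t₁ t₂
    have hre : ∑ k₁ ∈ Icc 1 (⌊M⌋₊ / (c * g)), ∑ k₂ ∈ Icc 1 (⌊M⌋₊ / (c * g)),
        ((μ (c * g * k₁) : ℝ) * ((psi (c * g * k₁))⁻¹ *
            P.eval (Real.log (M / ((c * g * k₁ : ℕ) : ℝ)) / Real.log M))) / ((c * g * k₁ : ℕ) : ℝ) *
          (((μ (c * g * k₂) : ℝ) * ((psi (c * g * k₂))⁻¹ *
            P.eval (Real.log (M / ((c * g * k₂ : ℕ) : ℝ)) / Real.log M))) / ((c * g * k₂ : ℕ) : ℝ)) *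
          (((k₁.divisors.card : ℝ) * D₁ k₁ * Real.log (M / ((c * g : ℕ) : ℝ) / k₁) ^ r₁) *
            ((k₂.divisors.card : ℝ) * D₂ k₂ * Real.log (M / ((c * g : ℕ) : ℝ) / k₂) ^ r₂) * Bp) =
        ∑ k₁ ∈ Icc 1 (⌊M⌋₊ / (c * g)), ∑ k₂ ∈ Icc 1 (⌊M⌋₊ / (c * g)),
        ((μ (c * g * k₁) : ℝ) * ((psi (c * g * k₁))⁻¹ *
            P.eval (Real.log (M / ((c * g * k₁ : ℕ) : ℝ)) / Real.log M))) / ((c * g * k₁ : ℕ) : ℝ) *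
          (((μ (c * g * k₂) : ℝ) * ((psi (c * g * k₂))⁻¹ *
            P.eval (Real.log (M / ((c * g * k₂ : ℕ) : ℝ)) / Real.log M))) / ((c * g * k₂ : ℕ) : ℝ)) *
          (t₁ k₁ * t₂ k₂) :=
      Finset.sum_congr rfl fun k₁ _ ↦ Finset.sum_congr rfl fun k₂ _ ↦ by simp only [ht₁, ht₂]; ring
    rw [hre, h]
    have h1 : ∑ c' ∈ Finset.range (P.natDegree + 1), P.coeff c' *
        ((∑ k ∈ Icc 1 ⌊M / ((c * g : ℕ) : ℝ)⌋₊, (if k.Coprime (c * g) then W k else 0) * t₁ k *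
          Real.log (M / ((c * g : ℕ) : ℝ) / k) ^ c') / Real.log M ^ c') = S₁ (c * g) := by
      simp only [hS₁, ht₁]
      refine Finset.sum_congr rfl fun c' _ ↦ ?_
      congr 1; congr 1
      refine Finset.sum_congr rfl fun k _ ↦ ?_
      rw [pow_add]; ring
    have h2 : ∑ c' ∈ Finset.range (P.natDegree + 1), P.coeff c' *
        ((∑ k ∈ Icc 1 ⌊M / ((c * g : ℕ) : ℝ)⌋₊, (if k.Coprime (c * g) then W k else 0) * t₂ k *
          Real.log (M / ((c * g : ℕ) : ℝ) / k) ^ c') / Real.log M ^ c') = Bp * S₂ (c * g) := by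
      simp only [hS₂, ht₂]
      rw [Finset.mul_sum]
      refine Finset.sum_congr rfl fun c' _ ↦ ?_
      have hk : ∑ k ∈ Icc 1 ⌊M / ((c * g : ℕ) : ℝ)⌋₊, (if k.Coprime (c * g) then W k else 0) *
          ((k.divisors.card : ℝ) * D₂ k * Real.log (M / ((c * g : ℕ) : ℝ) / k) ^ r₂ * Bp) *
            Real.log (M / ((c * g : ℕ) : ℝ) / k) ^ c' =
          Bp * ∑ k ∈ Icc 1 ⌊M / ((c * g : ℕ) : ℝ)⌋₊, (if k.Coprime (c * g) then W k else 0) *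
            ((k.divisors.card : ℝ) * D₂ k) * Real.log (M / ((c * g : ℕ) : ℝ) / k) ^ (c' + r₂) := by
        rw [Finset.mul_sum]
        exact Finset.sum_congr rfl fun k _ ↦ by rw [pow_add]; ring
      rw [hk]; ring
    rw [h1, h2]; ring
  rw [Finset.sum_congr rfl fun c hc ↦ Finset.sum_congr rfl fun g hg ↦ congrArg _ (hinner c hc g hg)]
  have hstep : ∀ c g : ℕ, (μ g : ℝ) * c * ((lam * Real.log M - Real.log g - Real.log (M / ((c * g : ℕ) : ℝ))) ^ p *
      (W (c * g) ^ 2 * (S₁ (c * g) * S₂ (c * g)))) =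
      ∑ t ∈ Finset.range (p + 1), (p.choose t : ℝ) * (-1) ^ t *
        ((μ g : ℝ) * c * Real.log g ^ t * (W (c * g) ^ 2 *
          ((lam * Real.log M - Real.log (M / ((c * g : ℕ) : ℝ))) ^ (p - t) * S₁ (c * g) * S₂ (c * g)))) := by
    intro c g
    rw [show lam * Real.log M - Real.log g - Real.log (M / ((c * g : ℕ) : ℝ)) =
      (lam * Real.log M - Real.log (M / ((c * g : ℕ) : ℝ))) - Real.log g by ring]
    exact moebius_mul_sub_log_pow_eq₂ g c _ (W (c * g) ^ 2) (S₁ (c * g)) (S₂ (c * g)) p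
  rw [Finset.sum_congr rfl fun c _ ↦ Finset.sum_congr rfl fun g _ ↦ hstep c g]
  rw [Finset.sum_congr rfl fun c _ ↦ Finset.sum_comm, Finset.sum_comm]
  refine Finset.sum_congr rfl fun t _ ↦ ?_
  rw [Finset.mul_sum (Icc 1 ⌊M⌋₊)]
  refine Finset.sum_congr rfl fun c _ ↦ ?_
  rw [Finset.mul_sum (Icc 1 (⌊M⌋₊ / c))]

/-! ### The decorated block asymptotic -/

/-- **THE TWO-SIDED DECORATED SHIFTED BLOCK ASYMPTOTIC** from master families `(R^{(1)}_{r₁}, s₁)`, `(R^{(2)}_{r₂}, s₂)` of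
the decorations `D₁` on `k₁`, `D₂` on `k₂` (`0 ≤ λ ≤ 1`; see the module docstring).
[cite: KowalskiMichelVanderKam2000, (23)–(28) and Prop. 5.1 — derivation (diagonal main term in real Selberg coordinates)] -/
theorem abs_selbergBlockDecorTwo_sub_le (P : ℝ[X]) (p r₁ r₂ : ℕ)
    {lam : ℝ} (hlam0 : 0 ≤ lam) (hlam1 : lam ≤ 1) {C₁ C₂ : ℝ} (hC₁ : 0 ≤ C₁) (hC₂ : 0 ≤ C₂)
    (hT₁ : ∀ M : ℝ, 3 ≤ M → ∀ n : ℕ, n ≠ 0 → (n : ℝ) ≤ M →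
      |(∑ c ∈ Finset.range (P.natDegree + 1), P.coeff c *
          ((∑ k ∈ Icc 1 ⌊M / n⌋₊, (if k.Coprime n then W k else 0) * ((k.divisors.card : ℝ) * D₁ k) *
            Real.log (M / n / k) ^ (c + r₁)) / Real.log M ^ c)) / Real.log M ^ r₁ -
        mainConst n * (R₁ r₁).eval (Real.log (M / n) / Real.log M) / Real.log M ^ s₁| ≤
        C₁ * divWeight n * ((1 + kappa n) / Real.log M ^ (s₁ + 1) + 1 / ((1 + Real.log (M / n)) ^ 2 * Real.log M ^ s₁)))
    (hT₂ : ∀ M : ℝ, 3 ≤ M → ∀ n : ℕ, n ≠ 0 → (n : ℝ) ≤ M →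
      |(∑ c ∈ Finset.range (P.natDegree + 1), P.coeff c *
          ((∑ k ∈ Icc 1 ⌊M / n⌋₊, (if k.Coprime n then W k else 0) * ((k.divisors.card : ℝ) * D₂ k) *
            Real.log (M / n / k) ^ (c + r₂)) / Real.log M ^ c)) / Real.log M ^ r₂ -
        mainConst n * (R₂ r₂).eval (Real.log (M / n) / Real.log M) / Real.log M ^ s₂| ≤
        C₂ * divWeight n * ((1 + kappa n) / Real.log M ^ (s₂ + 1) + 1 / ((1 + Real.log (M / n)) ^ 2 * Real.log M ^ s₂))) :
    ∃ C : ℝ, 0 < C ∧ ∀ M : ℝ, 3 ≤ M →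
      |∑ c ∈ Icc 1 ⌊M⌋₊, ∑ g ∈ Icc 1 (⌊M⌋₊ / c), (μ g : ℝ) * c *
          ∑ k₁ ∈ Icc 1 (⌊M⌋₊ / (c * g)), ∑ k₂ ∈ Icc 1 (⌊M⌋₊ / (c * g)),
            ((μ (c * g * k₁) : ℝ) * ((psi (c * g * k₁))⁻¹ *
                P.eval (Real.log (M / ((c * g * k₁ : ℕ) : ℝ)) / Real.log M))) / ((c * g * k₁ : ℕ) : ℝ) *
              (((μ (c * g * k₂) : ℝ) * ((psi (c * g * k₂))⁻¹ *
                P.eval (Real.log (M / ((c * g * k₂ : ℕ) : ℝ)) / Real.log M))) / ((c * g * k₂ : ℕ) : ℝ)) *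
              (((k₁.divisors.card : ℝ) * D₁ k₁ * Real.log (M / ((c * g : ℕ) : ℝ) / k₁) ^ r₁) *
                ((k₂.divisors.card : ℝ) * D₂ k₂ * Real.log (M / ((c * g : ℕ) : ℝ) / k₂) ^ r₂) *
                (lam * Real.log M - Real.log g - Real.log (M / ((c * g : ℕ) : ℝ))) ^ p) -
        (π ^ 2 / 6) ^ 2 * (∫ u in (0 : ℝ)..1,
            (((Polynomial.C lam - X) ^ p * R₁ r₁) * R₂ r₂).eval u) *
          Real.log M ^ (p + r₁ + r₂) * Real.log M / Real.log M ^ (s₁ + s₂)| ≤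
        C * Real.log M ^ (p + r₁ + r₂) / Real.log M ^ (s₁ + s₂) := by
  obtain ⟨C₀, hC₀, h0⟩ := abs_harmonicShiftedDecorTwo_sub_le P D₁ D₂ R₁ R₂ s₁ s₂ p r₁ r₂ hlam0 hlam1 hC₁ hC₂ hT₁ hT₂
  -- crude size of the decorated coordinate
  obtain ⟨K₁, hK₁, hb₁⟩ := abs_profileCoord_crude_le (R₁ r₁) s₁
    (fun M n ↦ (∑ c ∈ Finset.range (P.natDegree + 1), P.coeff c *
      ((∑ k ∈ Icc 1 ⌊M / n⌋₊, (if k.Coprime n then W k else 0) * ((k.divisors.card : ℝ) * D₁ k) *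
        Real.log (M / n / k) ^ (c + r₁)) / Real.log M ^ c)) / Real.log M ^ r₁) hC₁ hT₁
  obtain ⟨K₂, hK₂, hb₂⟩ := abs_profileCoord_crude_le (R₂ r₂) s₂
    (fun M n ↦ (∑ c ∈ Finset.range (P.natDegree + 1), P.coeff c *
      ((∑ k ∈ Icc 1 ⌊M / n⌋₊, (if k.Coprime n then W k else 0) * ((k.divisors.card : ℝ) * D₂ k) *
        Real.log (M / n / k) ^ (c + r₂)) / Real.log M ^ c)) / Real.log M ^ r₂) hC₂ hT₂
  have hb₁' : ∀ M : ℝ, 3 ≤ M → ∀ n : ℕ, n ≠ 0 → (n : ℝ) ≤ M →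
      |∑ c ∈ Finset.range (P.natDegree + 1), P.coeff c *
          ((∑ k ∈ Icc 1 ⌊M / n⌋₊, (if k.Coprime n then W k else 0) * ((k.divisors.card : ℝ) * D₁ k) *
            Real.log (M / n / k) ^ (c + r₁)) / Real.log M ^ c)| ≤
        K₁ * divWeight n * Real.log M ^ r₁ / Real.log M ^ s₁ := by
    intro M hM n hn hnM
    have hℓ1 : 1 ≤ Real.log M := one_le_log_of_three_le hM
    have hℓpos : 0 < Real.log M := by linarith
    have h' := hb₁ M hM n hn hnM
    rw [abs_div, abs_of_pos (pow_pos hℓpos r₁), div_le_iff₀ (pow_pos hℓpos r₁)] at h'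
    calc _ ≤ K₁ * divWeight n / Real.log M ^ s₁ * Real.log M ^ r₁ := h'
      _ = K₁ * divWeight n * Real.log M ^ r₁ / Real.log M ^ s₁ := by ring
  have hb₂' : ∀ M : ℝ, 3 ≤ M → ∀ n : ℕ, n ≠ 0 → (n : ℝ) ≤ M →
      |∑ c ∈ Finset.range (P.natDegree + 1), P.coeff c *
          ((∑ k ∈ Icc 1 ⌊M / n⌋₊, (if k.Coprime n then W k else 0) * ((k.divisors.card : ℝ) * D₂ k) *
            Real.log (M / n / k) ^ (c + r₂)) / Real.log M ^ c)| ≤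
        K₂ * divWeight n * Real.log M ^ r₂ / Real.log M ^ s₂ := by
    intro M hM n hn hnM
    have hℓ1 : 1 ≤ Real.log M := one_le_log_of_three_le hM
    have hℓpos : 0 < Real.log M := by linarith
    have h' := hb₂ M hM n hn hnM
    rw [abs_div, abs_of_pos (pow_pos hℓpos r₂), div_le_iff₀ (pow_pos hℓpos r₂)] at h'
    calc _ ≤ K₂ * divWeight n / Real.log M ^ s₂ * Real.log M ^ r₂ := h'
      _ = K₂ * divWeight n * Real.log M ^ r₂ / Real.log M ^ s₂ := by ring
  have hex : ∀ t : ℕ, ∃ C : ℝ, 0 < C ∧ (1 ≤ t → ∀ M : ℝ, 3 ≤ M →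
      |∑ c ∈ Icc 1 ⌊M⌋₊, ∑ g ∈ Icc 1 (⌊M⌋₊ / c), (μ g : ℝ) * c * Real.log g ^ t * (W (c * g) ^ 2 *
          ((lam * Real.log M - Real.log (M / ((c * g : ℕ) : ℝ))) ^ (p - t) *
            (∑ c' ∈ Finset.range (P.natDegree + 1), P.coeff c' *
              ((∑ k ∈ Icc 1 ⌊M / ((c * g : ℕ) : ℝ)⌋₊, (if k.Coprime (c * g) then W k else 0) *
                ((k.divisors.card : ℝ) * D₁ k) * Real.log (M / ((c * g : ℕ) : ℝ) / k) ^ (c' + r₁)) / Real.log M ^ c')) *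
            (∑ c' ∈ Finset.range (P.natDegree + 1), P.coeff c' *
              ((∑ k ∈ Icc 1 ⌊M / ((c * g : ℕ) : ℝ)⌋₊, (if k.Coprime (c * g) then W k else 0) * ((k.divisors.card : ℝ) * D₂ k) *
                Real.log (M / ((c * g : ℕ) : ℝ) / k) ^ (c' + r₂)) / Real.log M ^ c'))))| ≤
        C * Real.log M ^ (t + (p - t) + r₁ + r₂) / Real.log M ^ (s₁ + s₂)) := by
    intro t
    by_cases ht : 1 ≤ t
    · obtain ⟨C, hC, h⟩ := abs_collapseShiftedDecorTwo_logPow_le P D₁ D₂ s₁ s₂ ht (p - t) r₁ r₂ hlam0 hlam1 hK₁ hK₂ hb₁' hb₂'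
      exact ⟨C, hC, fun _ ↦ h⟩
    · exact ⟨1, one_pos, fun h ↦ absurd h ht⟩
  choose Ct hCt0 hCt using hex
  have hKsum : 0 ≤ ∑ t ∈ Finset.range p, (p.choose (t + 1) : ℝ) * Ct (t + 1) :=
    Finset.sum_nonneg fun t _ ↦ by have := hCt0 (t + 1); positivity
  refine ⟨C₀ + ∑ t ∈ Finset.range p, (p.choose (t + 1) : ℝ) * Ct (t + 1), by positivity, fun M hM ↦ ?_⟩
  have hℓ1 : 1 ≤ Real.log M := one_le_log_of_three_le hM
  have hℓpos : 0 < Real.log M := by linarith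
  set Xe : ℝ := Real.log M ^ (p + r₁ + r₂) / Real.log M ^ (s₁ + s₂) with hXe
  rw [selbergBlockDecorTwo_expand D₁ D₂ P M lam p r₁ r₂]
  refine (abs_sum_range_succ_sub_le₂ _ _ Xe C₀ (fun t ↦ (p.choose t : ℝ) * Ct t) ?_ (fun t ht ↦ ?_)).trans_eq
    (by rw [hXe]; ring)
  · have h0' := h0 M hM
    simp only [Nat.choose_zero_right, Nat.cast_one, pow_zero, mul_one, one_mul, Nat.sub_zero]
    rw [selbergCollapse_zero ⌊M⌋₊ (fun n ↦ W n ^ 2 * ((lam * Real.log M - Real.log (M / n)) ^ p *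
      (∑ c ∈ Finset.range (P.natDegree + 1), P.coeff c *
        ((∑ k ∈ Icc 1 ⌊M / n⌋₊, (if k.Coprime n then W k else 0) * ((k.divisors.card : ℝ) * D₁ k) *
          Real.log (M / n / k) ^ (c + r₁)) / Real.log M ^ c)) *
      (∑ c ∈ Finset.range (P.natDegree + 1), P.coeff c *
        ((∑ k ∈ Icc 1 ⌊M / n⌋₊, (if k.Coprime n then W k else 0) * ((k.divisors.card : ℝ) * D₂ k) *
          Real.log (M / n / k) ^ (c + r₂)) / Real.log M ^ c))))]
    have hre : ∑ n ∈ Icc 1 ⌊M⌋₊, (Nat.totient n : ℝ) * (W n ^ 2 * ((lam * Real.log M - Real.log (M / n)) ^ p *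
        (∑ c ∈ Finset.range (P.natDegree + 1), P.coeff c *
          ((∑ k ∈ Icc 1 ⌊M / n⌋₊, (if k.Coprime n then W k else 0) * ((k.divisors.card : ℝ) * D₁ k) *
            Real.log (M / n / k) ^ (c + r₁)) / Real.log M ^ c)) *
        (∑ c ∈ Finset.range (P.natDegree + 1), P.coeff c *
          ((∑ k ∈ Icc 1 ⌊M / n⌋₊, (if k.Coprime n then W k else 0) * ((k.divisors.card : ℝ) * D₂ k) *
            Real.log (M / n / k) ^ (c + r₂)) / Real.log M ^ c)))) =
        ∑ n ∈ Icc 1 ⌊M⌋₊, (Nat.totient n : ℝ) * W n ^ 2 * ((lam * Real.log M - Real.log (M / n)) ^ p *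
        (∑ c ∈ Finset.range (P.natDegree + 1), P.coeff c *
          ((∑ k ∈ Icc 1 ⌊M / n⌋₊, (if k.Coprime n then W k else 0) * ((k.divisors.card : ℝ) * D₁ k) *
            Real.log (M / n / k) ^ (c + r₁)) / Real.log M ^ c)) *
        (∑ c ∈ Finset.range (P.natDegree + 1), P.coeff c *
          ((∑ k ∈ Icc 1 ⌊M / n⌋₊, (if k.Coprime n then W k else 0) * ((k.divisors.card : ℝ) * D₂ k) *
            Real.log (M / n / k) ^ (c + r₂)) / Real.log M ^ c))) :=
      Finset.sum_congr rfl fun n _ ↦ by ring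
    rw [hre, hXe, ← mul_div_assoc]
    exact h0'
  · have htp : t < p := Finset.mem_range.1 ht
    have h := hCt (t + 1) (by omega) M hM
    have e : t + 1 + (p - (t + 1)) + r₁ + r₂ = p + r₁ + r₂ := by omega
    rw [e] at h
    have h' : |∑ c ∈ Icc 1 ⌊M⌋₊, ∑ g ∈ Icc 1 (⌊M⌋₊ / c), (μ g : ℝ) * c * Real.log g ^ (t + 1) * (W (c * g) ^ 2 *
          ((lam * Real.log M - Real.log (M / ((c * g : ℕ) : ℝ))) ^ (p - (t + 1)) *
            (∑ c' ∈ Finset.range (P.natDegree + 1), P.coeff c' *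
              ((∑ k ∈ Icc 1 ⌊M / ((c * g : ℕ) : ℝ)⌋₊, (if k.Coprime (c * g) then W k else 0) *
                ((k.divisors.card : ℝ) * D₁ k) * Real.log (M / ((c * g : ℕ) : ℝ) / k) ^ (c' + r₁)) / Real.log M ^ c')) *
            (∑ c' ∈ Finset.range (P.natDegree + 1), P.coeff c' *
              ((∑ k ∈ Icc 1 ⌊M / ((c * g : ℕ) : ℝ)⌋₊, (if k.Coprime (c * g) then W k else 0) * ((k.divisors.card : ℝ) * D₂ k) *
                Real.log (M / ((c * g : ℕ) : ℝ) / k) ^ (c' + r₂)) / Real.log M ^ c'))))| ≤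
        Ct (t + 1) * Xe := by
      rw [hXe, ← mul_div_assoc]; exact h
    rw [abs_mul, abs_mul, abs_pow, abs_neg, abs_one, one_pow, mul_one,
      abs_of_nonneg (by positivity : (0 : ℝ) ≤ (p.choose (t + 1) : ℝ)), mul_assoc]
    exact mul_le_mul_of_nonneg_left h' (by positivity)


/-! ### The instance `D₁ = D₂ = P₂` -/

/-- **The two-sided `P₂`-block asymptotic** (`0 ≤ λ ≤ 1`, `P₀ = P₁ = 0`):
`Sel(τP₂(k₁)ℓ⁺^{r₁}·τP₂(k₂)ℓ⁺^{r₂}·B^p) = (π²/6)²(∫₀¹(λ−u)^p(−2u^{r₁}P)(−2u^{r₂}P))·log^{p+r₁+r₂}M·log M + O(log^{p+r₁+r₂}M)`.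
[cite: KowalskiMichelVanderKam2000, (23)–(28) and Prop. 5.1 — derivation] -/
theorem abs_selbergBlockPrimeSqTwo_sub_le (P : ℝ[X]) (hP0 : P.coeff 0 = 0) (hP1 : P.coeff 1 = 0) (p r₁ r₂ : ℕ)
    {lam : ℝ} (hlam0 : 0 ≤ lam) (hlam1 : lam ≤ 1) :
    ∃ C : ℝ, 0 < C ∧ ∀ M : ℝ, 3 ≤ M →
      |∑ c ∈ Icc 1 ⌊M⌋₊, ∑ g ∈ Icc 1 (⌊M⌋₊ / c), (μ g : ℝ) * c *
          ∑ k₁ ∈ Icc 1 (⌊M⌋₊ / (c * g)), ∑ k₂ ∈ Icc 1 (⌊M⌋₊ / (c * g)),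
            ((μ (c * g * k₁) : ℝ) * ((psi (c * g * k₁))⁻¹ *
                P.eval (Real.log (M / ((c * g * k₁ : ℕ) : ℝ)) / Real.log M))) / ((c * g * k₁ : ℕ) : ℝ) *
              (((μ (c * g * k₂) : ℝ) * ((psi (c * g * k₂))⁻¹ *
                P.eval (Real.log (M / ((c * g * k₂ : ℕ) : ℝ)) / Real.log M))) / ((c * g * k₂ : ℕ) : ℝ)) *
              (((k₁.divisors.card : ℝ) * (∑ p ∈ k₁.primeFactors, Real.log p ^ 2) *
                  Real.log (M / ((c * g : ℕ) : ℝ) / k₁) ^ r₁) *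
                ((k₂.divisors.card : ℝ) * (∑ p ∈ k₂.primeFactors, Real.log p ^ 2) *
                  Real.log (M / ((c * g : ℕ) : ℝ) / k₂) ^ r₂) *
                (lam * Real.log M - Real.log g - Real.log (M / ((c * g : ℕ) : ℝ))) ^ p) -
        (π ^ 2 / 6) ^ 2 * (∫ u in (0 : ℝ)..1,
            (((Polynomial.C lam - X) ^ p * (-(2 : ℝ) • (X ^ r₁ * P))) * (-(2 : ℝ) • (X ^ r₂ * P))).eval u) *
          Real.log M ^ (p + r₁ + r₂) * Real.log M / Real.log M ^ (0 + 0)| ≤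
        C * Real.log M ^ (p + r₁ + r₂) / Real.log M ^ (0 + 0) := by
  obtain ⟨C₁, hC₁, h₁⟩ := abs_shiftedCoordPrimeSq_sub_le P hP0 hP1 r₁
  obtain ⟨C₂, hC₂, h₂⟩ := abs_shiftedCoordPrimeSq_sub_le P hP0 hP1 r₂
  exact abs_selbergBlockDecorTwo_sub_le (fun k ↦ ∑ p ∈ k.primeFactors, Real.log p ^ 2)
    (fun k ↦ ∑ p ∈ k.primeFactors, Real.log p ^ 2) (fun r' : ℕ ↦ -(2 : ℝ) • (X ^ r' * P))
    (fun r' : ℕ ↦ -(2 : ℝ) • (X ^ r' * P)) 0 0 P p r₁ r₂ hlam0 hlam1 hC₁ hC₂ h₁ h₂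

end Summit.Parity.GeneralizedHardyLittlewood.Theorems.MomentsBeyondDiagonal.DiagKernel

end
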